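import Summits.QuantumFields.BalabanUV.Gaps.D1PinnedColourRayReadings
import Summits.QuantumFields.BalabanUV.Gaps.D1PinnedColourLineQuartic

/-!
# D1 (pinned family) — along every AFFINE LINE of colour triples the limit one-loop coefficient is a QUARTIC; five members decide (D1) on a line, 125 members decide it on all of colour space; (D1) holds at ≤ 4 members of a line or at all — HYPOTHESIS-FREE at the pin

Census row 79 (item (v), file 4 of 4); the affine-line twin of `D1PinnedColourRayReadings`.  CONTENT (all [folklore]; 0 def, 0 sorry): §1 `axVertexOfK_path₃`; §2 **`bubble_path₃`**
(the bubble along an affine-quadratic path is a full quartic), `bubble_path₃_nodes`; §3 **`S_line`** (an2's jet-datum stencil along `c⃗₀ + s·c⃗₁` is `s²A_j + sB_j + C_j`, certified),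
**`TbalOf_JsBalAn1_line_nodes`** (`1 ≤ Lc`, ANY `cE₂ cB Tc`, any box root, every level, every entry: `TbalOf (JsBalAn1 r (c⃗₀ + t·c⃗₁)) j = Σᵢ wᵢ · TbalOf (JsBalAn1 r (c⃗₀ + sᵢ·c⃗₁)) j` for
`Σ wᵢ sᵢ^k = t^k`, `k = 0…4`), `secondMoment_JsBalAn1_line_nodes`; §4 at the pin `cE₂ := Lc^8`, `2 ≤ Lc`: **`lim_JsBalAn1_line_nodes`**, **`lim_line_fiveMembers`** (Lagrange at
`t = 0,1,2,3,4`), **`d1Drift_line_of_fiveMembers`**, `quartic_dichotomy`, **`d1Drift_line_dichotomy`**, **`d1Drift_of_grid125`** ((D1) at the 125 members `(cE₀ + i, cVH₀ + j, cΛ₀ + k)`,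
`i, j, k ∈ {0,…,4}`, of a unit grid ⟹ (D1) at EVERY colour triple — three passes of the five-member law along the axis directions).  READING: with `D1PinnedColourRayReadings` (total
degree ≤ 4 along rays), the colour part `φ` of the four-piece normal form (`D1PinnedSecondOrderNormalForm`) is a polynomial map of total degree ≤ 4 on ℝ³ in the restriction-to-lines sense;
(D1) at the pinned literal — as a condition on print's UNCOMPUTED first-order colour triple — holds on all of a line or on at most four of its points, and FINITELY MANY (125) members decide
it on all of colour space.  Imports `D1PinnedColourRayReadings` (p381335), `D1PinnedColourLineQuartic`.

Provenance: cell pub-balaban-gaps, seat g1-p1 GEN 12 (prover-pub-balaban-gaps-g1-p1-g12-0), 2026-08-24.  HONEST FRAMING: [folklore] kernel algebra BY NAME over tree theorems;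
NOTHING of Bałaban's asserted ([Balaban1987RG1] Thm 2 is UNPROVED IN PRINT); NO coefficient computed or signed; binder (D1) of B12 Thm 2 at the β-lead's pinned literal is NOT
discharged; NOT `BetaPertH`, NOT continuum, NOT Clay.
-/

noncomputable section

open Finset
open scoped BigOperators
open Literature.MathematicalPhysics.QuantumFieldTheory Balaban1983to89 Balaban1983to89.Beta Filter Topology
open ExpKernelCalculus (MKer Decays BiLoc VertexFamily VertexFamily₂ comp hessKer tadpole bubble)
open OneStepResolventKernel (Fib LocStencil wsum)
open OneStepKernelFamily (KInvStep decays_KInvStep TbalOf D1Drift hTA_TbalOf colH)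
open DecimatedMomentSummable (AbsMoment₂)
open BalabanStepJets (S0 locStencil_S0)
open BalabanStepJetsSucc (JsBal0Of Sstep e3Of wE locStencil_e3Of locStencil_Sstep JsBal0Of_S_zero JsBal0Of_S_succ)
open BalabanStepW2 (WbalOf T2Of T2Of_loc WbalT2Of vertexFamily₂_WbalOf')
open StepJetData (locStencil_smul locStencil_add)
open AxialProjector (axProj)
open AxialDressing (axDressK axVertexOfK decays_axDressK summable_axProj summable_col_of_decays vertexFamily_axVertexOfK')
open KernelReflection (bubble_smul_left bubble_smul_right tadpole_smul)
open AffineAveraging (box toSite)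
open AveragingMixedJetTables (vh₂SAt mixFFAt)
open RateCertificate (CauchyRate)
open ScalewiseWitness (secondMoment_add secondMoment_smul absMoment₂_add)
open Summit.QuantumFields.BalabanUV.Beta.TameKernelCalculus (Spr Loc tadpole_add bubble_add_left bubble_add_right)
open Summit.QuantumFields.BalabanUV.Beta.ChartConjugationReflection (wsum_add abs_le_of_locStencil)
open Summit.QuantumFields.BalabanUV.Beta.MixedJetTablesPlug (JsBalAn1 TbalOf_JsBalAn1 hB_an1 hmix_an1)
open Summit.QuantumFields.BalabanUV.Beta.GAN24.StencilSlotOfE3 (one_le_of_two_le)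
open Summit.QuantumFields.BalabanUV.Gaps.CapTailPinnedLimitSign (tendsto_pinned d1Drift_pinned_iff_lim_eq)
open Summit.QuantumFields.BalabanUV.Gaps.D1PinnedFirstOrderBilinear (certs_zero)
open Summit.QuantumFields.BalabanUV.Gaps.D1PinnedColourScaling (S0_colourScale)
open Summit.QuantumFields.BalabanUV.Gaps.D1PinnedColourRayReadings (axVertexOfK_add axVertexOfK_smul axVertexOfK_path loc_axVertexOfK tadpole_wsum5 loc_WbalT2Of_an1
  secondMoment_wsum5)
open Summit.QuantumFields.BalabanUV.Gaps.D1PinnedColourLineTables (S0_colourAdd)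
open Summit.QuantumFields.BalabanUV.Gaps.D1PinnedColourLineTables (Sstep_line)
open Summit.QuantumFields.BalabanUV.Gaps.D1PinnedColourLineQuartic (WbalOf_line_nodes)

namespace Summit.QuantumFields.BalabanUV.Gaps.D1PinnedColourLineReadings

variable {d : ℕ} {N : ℕ}

/-! ## §1 The `Π`-dressed vertex along an affine-quadratic path -/

/-- [folklore] `V^Π_K(s²A + sB + C) b = s² • V^Π_K(A) b + s • V^Π_K(B) b + V^Π_K(C) b` (decaying `K`; `A, B, C` local stencil families; `axVertexOfK_add` + `axVertexOfK_path`). -/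
theorem axVertexOfK_path₃ (hN : 1 ≤ N) {K : MKer (d + 1) (Fib d)} {C δ : ℝ} (hK : Decays K C δ) (hδ : 0 < δ)
    {A B Cc : Fin (d + 1) → (Fin (d + 1) → ℤ) → MKer (d + 1) (Fib d)} (hA : ∃ C δ : ℝ, 0 < δ ∧ LocStencil A C δ) (hB : ∃ C δ : ℝ, 0 < δ ∧ LocStencil B C δ)
    (hC : ∃ C' δ : ℝ, 0 < δ ∧ LocStencil Cc C' δ) (s : ℝ) (μ : Fin (d + 1)) (y : Fin (d + 1) → ℤ) :
    axVertexOfK K N (fun κ u => s ^ 2 • A κ u + s • B κ u + Cc κ u) μ y = s ^ 2 • axVertexOfK K N A μ y + s • axVertexOfK K N B μ y + axVertexOfK K N Cc μ y := by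
  obtain ⟨CA, δA, hδA, hAl⟩ := id hA
  obtain ⟨CB, δB, hδB, hBl⟩ := id hB
  obtain ⟨CC, δC, hδC, hCl⟩ := hC
  have bAB : ∀ κ u x z a b, |(s ^ 2 • A κ u + s • B κ u) x z a b| ≤ |s ^ 2| * CA + |s| * CB := fun κ u x z a b => by
    simp only [Pi.add_apply, Pi.smul_apply, smul_eq_mul]
    refine (abs_add_le _ _).trans (add_le_add ?_ ?_)
    · rw [abs_mul]; exact mul_le_mul_of_nonneg_left (abs_le_of_locStencil hAl hδA.le κ u x z a b) (abs_nonneg _)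
    · rw [abs_mul]; exact mul_le_mul_of_nonneg_left (abs_le_of_locStencil hBl hδB.le κ u x z a b) (abs_nonneg _)
  have bC : ∀ κ u x z a b, |Cc κ u x z a b| ≤ CC := fun κ u x z a b => abs_le_of_locStencil hCl hδC.le κ u x z a b
  rw [axVertexOfK_add (A := fun κ u => s ^ 2 • A κ u + s • B κ u) (B := Cc) hN hK hδ bAB bC, axVertexOfK_path hN hK hδ hA hB]

/-! ## §2 The bubble along an affine-quadratic path is a full quartic; five-node identity with all moments -/

section Traces

variable {D : ℕ} {F : Type*} [Fintype F]

/-- [folklore] **THE BUBBLE ALONG AN AFFINE-QUADRATIC PATH** (spread `𝔄`, localised legs):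
`bubble 𝔄 (s²a + sb + c) (s²a′ + sb′ + c′) = s⁴·bub(a,a′) + s³·(bub(a,b′) + bub(b,a′)) + s²·(bub(a,c′) + bub(b,b′) + bub(c,a′)) + s·(bub(b,c′) + bub(c,b′)) + bub(c,c′)`. -/
theorem bubble_path₃ {𝔄 a b c a' b' c' : MKer D F} (h𝔄 : Spr 𝔄) (ha : Loc a) (hb : Loc b) (hc : Loc c) (ha' : Loc a') (hb' : Loc b') (hc' : Loc c') (s : ℝ) :
    bubble 𝔄 (s ^ 2 • a + s • b + c) (s ^ 2 • a' + s • b' + c') =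
      s ^ 4 * bubble 𝔄 a a' + s ^ 3 * (bubble 𝔄 a b' + bubble 𝔄 b a') + s ^ 2 * (bubble 𝔄 a c' + bubble 𝔄 b b' + bubble 𝔄 c a') +
        s * (bubble 𝔄 b c' + bubble 𝔄 c b') + bubble 𝔄 c c' := by
  have hR : Loc (s ^ 2 • a' + s • b' + c') := ((ha'.smul _).add (hb'.smul _)).add hc'
  rw [bubble_add_left h𝔄 ((ha.smul _).add (hb.smul _)) hc hR, bubble_add_left h𝔄 (ha.smul _) (hb.smul _) hR,
    bubble_add_right h𝔄 (ha.smul _) ((ha'.smul _).add (hb'.smul _)) hc', bubble_add_right h𝔄 (ha.smul _) (ha'.smul _) (hb'.smul _),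
    bubble_add_right h𝔄 (hb.smul _) ((ha'.smul _).add (hb'.smul _)) hc', bubble_add_right h𝔄 (hb.smul _) (ha'.smul _) (hb'.smul _),
    bubble_add_right h𝔄 hc ((ha'.smul _).add (hb'.smul _)) hc', bubble_add_right h𝔄 hc (ha'.smul _) (hb'.smul _)]
  simp only [bubble_smul_left, bubble_smul_right]
  ring

/-- [folklore] **THE FIVE-NODE IDENTITY FOR THE BUBBLE ALONG AN AFFINE-QUADRATIC PATH** (ALL moments `Σ wᵢ sᵢ^k = t^k`, `k = 0,…,4`):
`bubble 𝔄 (x(t)) (x′(t)) = Σ wᵢ · bubble 𝔄 (x(sᵢ)) (x′(sᵢ))`, `x(s) = s²a + sb + c`, `x′(s) = s²a′ + sb′ + c′`. -/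
theorem bubble_path₃_nodes {𝔄 a b c a' b' c' : MKer D F} (h𝔄 : Spr 𝔄) (ha : Loc a) (hb : Loc b) (hc : Loc c) (ha' : Loc a') (hb' : Loc b') (hc' : Loc c')
    (t s₀ s₁ s₂ s₃ s₄ w₀ w₁ w₂ w₃ w₄ : ℝ) (hm0 : w₀ + w₁ + w₂ + w₃ + w₄ = 1) (hm1 : w₀ * s₀ + w₁ * s₁ + w₂ * s₂ + w₃ * s₃ + w₄ * s₄ = t)
    (hm2 : w₀ * s₀ ^ 2 + w₁ * s₁ ^ 2 + w₂ * s₂ ^ 2 + w₃ * s₃ ^ 2 + w₄ * s₄ ^ 2 = t ^ 2)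
    (hm3 : w₀ * s₀ ^ 3 + w₁ * s₁ ^ 3 + w₂ * s₂ ^ 3 + w₃ * s₃ ^ 3 + w₄ * s₄ ^ 3 = t ^ 3) (hm4 : w₀ * s₀ ^ 4 + w₁ * s₁ ^ 4 + w₂ * s₂ ^ 4 + w₃ * s₃ ^ 4 + w₄ * s₄ ^ 4 = t ^ 4) :
    bubble 𝔄 (t ^ 2 • a + t • b + c) (t ^ 2 • a' + t • b' + c') =
      w₀ * bubble 𝔄 (s₀ ^ 2 • a + s₀ • b + c) (s₀ ^ 2 • a' + s₀ • b' + c') + w₁ * bubble 𝔄 (s₁ ^ 2 • a + s₁ • b + c) (s₁ ^ 2 • a' + s₁ • b' + c') +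
        w₂ * bubble 𝔄 (s₂ ^ 2 • a + s₂ • b + c) (s₂ ^ 2 • a' + s₂ • b' + c') + w₃ * bubble 𝔄 (s₃ ^ 2 • a + s₃ • b + c) (s₃ ^ 2 • a' + s₃ • b' + c') +
        w₄ * bubble 𝔄 (s₄ ^ 2 • a + s₄ • b + c) (s₄ ^ 2 • a' + s₄ • b' + c') := by
  simp only [bubble_path₃ h𝔄 ha hb hc ha' hb' hc']
  linear_combination (-(bubble 𝔄 a a')) * hm4 - (bubble 𝔄 a b' + bubble 𝔄 b a') * hm3 - (bubble 𝔄 a c' + bubble 𝔄 b b' + bubble 𝔄 c a') * hm2 -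
    (bubble 𝔄 b c' + bubble 𝔄 c b') * hm1 - bubble 𝔄 c c' * hm0

end Traces

/-! ## §3 The pinned family's step kernels and (1.22) coefficients along an affine line of colour triples in the five-node form (`1 ≤ Lc`, any `cE₂ cB Tc`, any box root) -/

section Kernels

variable {Lc : ℕ} [NeZero Lc]

/-- [folklore] **THE FIRST-ORDER STENCIL OF an2's JET DATUM ALONG AN AFFINE LINE OF COLOUR TRIPLES IS AN AFFINE-QUADRATIC PATH OF CERTIFIED FAMILIES** (every level, whatever second-order
tables the datum carries): member `0`: `S₀(c⃗₀ + s·c⃗₁) = s²•0 + s•S₀(c⃗₁) + S₀(c⃗₀)` (`S0_colourAdd`, `S0_colourScale`); member `j+1`: `LineTables.Sstep_line`. -/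
theorem S_line (hLc : 1 ≤ Lc) (cE₀ cVH₀ cΛ₀ cE₁ cVH₁ cΛ₁ : ℝ) : ∀ j : ℕ, ∃ A B C : Fin (d + 1) → (Fin (d + 1) → ℤ) → MKer (d + 1) (Fib d),
    (∃ C' δ : ℝ, 0 < δ ∧ LocStencil A C' δ) ∧ (∃ C' δ : ℝ, 0 < δ ∧ LocStencil B C' δ) ∧ (∃ C' δ : ℝ, 0 < δ ∧ LocStencil C C' δ) ∧
      ∀ (s : ℝ) (W : ℕ → Fin (d + 1) → (Fin (d + 1) → ℤ) → Fin (d + 1) → (Fin (d + 1) → ℤ) → MKer (d + 1) (Fib d)) (Cw δw : ℕ → ℝ) (hδw : ∀ j, 0 < δw j)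
        (hW : ∀ j, VertexFamily₂ (W j) Lc (Cw j) (δw j)),
        (JsBal0Of hLc (cE₀ + s * cE₁) (cVH₀ + s * cVH₁) (cΛ₀ + s * cΛ₁) W Cw δw hδw hW j).S = fun κ u => s ^ 2 • A κ u + s • B κ u + C κ u
  | 0 => ⟨fun _ _ => 0, S0 d Lc cE₁ cVH₁ cΛ₁, S0 d Lc cE₀ cVH₀ cΛ₀, (certs_zero (d := d) (N := Lc)).1, locStencil_S0 hLc cE₁ cVH₁ cΛ₁, locStencil_S0 hLc cE₀ cVH₀ cΛ₀,
      fun s W Cw δw hδw hW => by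
      rw [JsBal0Of_S_zero, S0_colourAdd, S0_colourScale]; funext κ u; simp only [Pi.add_apply, Pi.smul_apply, smul_zero, zero_add]; exact add_comm _ _⟩
  | j + 1 => by
    obtain ⟨A, B, C, hA, hB, hC, hS⟩ := Sstep_line (d := d) (Lc := Lc) hLc cE₀ cVH₀ cΛ₀ cE₁ cVH₁ cΛ₁ (j + 1)
    exact ⟨A, B, C, hA, hB, hC, fun s W Cw δw hδw hW => by rw [JsBal0Of_S_succ, hS s]⟩

variable {r : Fin (3 + 1) → ℕ}

/-- [folklore] **THE PINNED FAMILY's STEP KERNELS ALONG AN AFFINE LINE OF COLOUR TRIPLES IN THE FIVE-NODE FORM** (`1 ≤ Lc`; any `cE₂, cB, Tc`; any box root; every level; every entry): for all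
nodes and weights with `Σ wᵢ sᵢ^k = t^k` (`k = 0,…,4`), `TbalOf (JsBalAn1 r (c⃗₀ + t·c⃗₁) cE₂ cB Tc) j μ ν z = Σᵢ wᵢ · TbalOf (JsBalAn1 r (c⃗₀ + sᵢ·c⃗₁) cE₂ cB Tc) j μ ν z` — `TbalOf_JsBalAn1`,
`S_line` + `axVertexOfK_path₃` (bubble legs), `bubble_path₃_nodes`, `LineQuartic.WbalOf_line_nodes` + `tadpole_wsum5` (tadpole slot). -/
theorem TbalOf_JsBalAn1_line_nodes (hLc : 1 ≤ Lc) (hr : r ∈ box (3 + 1) Lc) (cE₀ cVH₀ cΛ₀ cE₁ cVH₁ cΛ₁ cE₂ cB : ℝ) (T : Fin 4 → Fin 4 → Fin 4 → Fin 4 → ℝ) (j : ℕ)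
    (t s₀ s₁ s₂ s₃ s₄ w₀ w₁ w₂ w₃ w₄ : ℝ) (hm0 : w₀ + w₁ + w₂ + w₃ + w₄ = 1) (hm1 : w₀ * s₀ + w₁ * s₁ + w₂ * s₂ + w₃ * s₃ + w₄ * s₄ = t)
    (hm2 : w₀ * s₀ ^ 2 + w₁ * s₁ ^ 2 + w₂ * s₂ ^ 2 + w₃ * s₃ ^ 2 + w₄ * s₄ ^ 2 = t ^ 2)
    (hm3 : w₀ * s₀ ^ 3 + w₁ * s₁ ^ 3 + w₂ * s₂ ^ 3 + w₃ * s₃ ^ 3 + w₄ * s₄ ^ 3 = t ^ 3) (hm4 : w₀ * s₀ ^ 4 + w₁ * s₁ ^ 4 + w₂ * s₂ ^ 4 + w₃ * s₃ ^ 4 + w₄ * s₄ ^ 4 = t ^ 4)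
    (μ ν : Fin 4) (z : Fin 4 → ℤ) :
    TbalOf Lc (JsBalAn1 hLc hr (cE₀ + t * cE₁) (cVH₀ + t * cVH₁) (cΛ₀ + t * cΛ₁) cE₂ cB T) j μ ν z =
      w₀ * TbalOf Lc (JsBalAn1 hLc hr (cE₀ + s₀ * cE₁) (cVH₀ + s₀ * cVH₁) (cΛ₀ + s₀ * cΛ₁) cE₂ cB T) j μ ν z +
        w₁ * TbalOf Lc (JsBalAn1 hLc hr (cE₀ + s₁ * cE₁) (cVH₀ + s₁ * cVH₁) (cΛ₀ + s₁ * cΛ₁) cE₂ cB T) j μ ν z +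
        w₂ * TbalOf Lc (JsBalAn1 hLc hr (cE₀ + s₂ * cE₁) (cVH₀ + s₂ * cVH₁) (cΛ₀ + s₂ * cΛ₁) cE₂ cB T) j μ ν z +
        w₃ * TbalOf Lc (JsBalAn1 hLc hr (cE₀ + s₃ * cE₁) (cVH₀ + s₃ * cVH₁) (cΛ₀ + s₃ * cΛ₁) cE₂ cB T) j μ ν z +
        w₄ * TbalOf Lc (JsBalAn1 hLc hr (cE₀ + s₄ * cE₁) (cVH₀ + s₄ * cVH₁) (cΛ₀ + s₄ * cΛ₁) cE₂ cB T) j μ ν z := by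
  obtain ⟨A, B, Cc, hA, hB, hC, hS⟩ := S_line (d := 3) (Lc := Lc) hLc cE₀ cVH₀ cΛ₀ cE₁ cVH₁ cΛ₁ j
  have hK := decays_KInvStep (Lc := Lc) (d := 3) j
  obtain ⟨δK, CK, hδK, -, hKd⟩ := id hK
  have h𝔄 : Spr (axDressK Lc (KInvStep (d := 3) Lc j)) := ⟨_, δK, hδK, decays_axDressK hLc hKd hδK.le⟩
  have lA : ∀ b : Fin 4 × (Fin 4 → ℤ), Loc (axVertexOfK (KInvStep (d := 3) Lc j) Lc A b.1 b.2) := fun b => loc_axVertexOfK hK hA b.1 b.2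
  have lB : ∀ b : Fin 4 × (Fin 4 → ℤ), Loc (axVertexOfK (KInvStep (d := 3) Lc j) Lc B b.1 b.2) := fun b => loc_axVertexOfK hK hB b.1 b.2
  have lC : ∀ b : Fin 4 × (Fin 4 → ℤ), Loc (axVertexOfK (KInvStep (d := 3) Lc j) Lc Cc b.1 b.2) := fun b => loc_axVertexOfK hK hC b.1 b.2
  have hV : ∀ (s : ℝ) (b : Fin 4 × (Fin 4 → ℤ)), axVertexOfK (KInvStep (d := 3) Lc j) Lc (fun κ u => s ^ 2 • A κ u + s • B κ u + Cc κ u) b.1 b.2 =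
      s ^ 2 • axVertexOfK (KInvStep (d := 3) Lc j) Lc A b.1 b.2 + s • axVertexOfK (KInvStep (d := 3) Lc j) Lc B b.1 b.2 + axVertexOfK (KInvStep (d := 3) Lc j) Lc Cc b.1 b.2 :=
    fun s b => axVertexOfK_path₃ hLc hKd hδK hA hB hC s b.1 b.2
  -- the tadpole slot
  have hW := WbalOf_line_nodes (d := 3) hLc cE₀ cVH₀ cΛ₀ cE₁ cVH₁ cΛ₁ cE₂ cB T (hB_an1 hLc hr) (hmix_an1 hLc hr) j t s₀ s₁ s₂ s₃ s₄ w₀ w₁ w₂ w₃ w₄ hm0 hm1 hm2 hm3 hm4 μ 0 ν z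
  have htad := tadpole_wsum5 h𝔄 (loc_WbalT2Of_an1 hLc hr (cE₀ + s₀ * cE₁) (cVH₀ + s₀ * cVH₁) (cΛ₀ + s₀ * cΛ₁) cE₂ cB T j μ 0 ν z)
    (loc_WbalT2Of_an1 hLc hr (cE₀ + s₁ * cE₁) (cVH₀ + s₁ * cVH₁) (cΛ₀ + s₁ * cΛ₁) cE₂ cB T j μ 0 ν z)
    (loc_WbalT2Of_an1 hLc hr (cE₀ + s₂ * cE₁) (cVH₀ + s₂ * cVH₁) (cΛ₀ + s₂ * cΛ₁) cE₂ cB T j μ 0 ν z)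
    (loc_WbalT2Of_an1 hLc hr (cE₀ + s₃ * cE₁) (cVH₀ + s₃ * cVH₁) (cΛ₀ + s₃ * cΛ₁) cE₂ cB T j μ 0 ν z)
    (loc_WbalT2Of_an1 hLc hr (cE₀ + s₄ * cE₁) (cVH₀ + s₄ * cVH₁) (cΛ₀ + s₄ * cΛ₁) cE₂ cB T j μ 0 ν z) w₀ w₁ w₂ w₃ w₄
  unfold BalabanStepW2.WbalT2Of at htad
  rw [← hW] at htad
  -- the bubble slot
  have hbub := bubble_path₃_nodes h𝔄 (lA (μ, 0)) (lB (μ, 0)) (lC (μ, 0)) (lA (ν, z)) (lB (ν, z)) (lC (ν, z)) t s₀ s₁ s₂ s₃ s₄ w₀ w₁ w₂ w₃ w₄ hm0 hm1 hm2 hm3 hm4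
  rw [TbalOf_JsBalAn1 hLc hr (cE₀ + t * cE₁) (cVH₀ + t * cVH₁) (cΛ₀ + t * cΛ₁) cE₂ cB T j,
    TbalOf_JsBalAn1 hLc hr (cE₀ + s₀ * cE₁) (cVH₀ + s₀ * cVH₁) (cΛ₀ + s₀ * cΛ₁) cE₂ cB T j, TbalOf_JsBalAn1 hLc hr (cE₀ + s₁ * cE₁) (cVH₀ + s₁ * cVH₁) (cΛ₀ + s₁ * cΛ₁) cE₂ cB T j,
    TbalOf_JsBalAn1 hLc hr (cE₀ + s₂ * cE₁) (cVH₀ + s₂ * cVH₁) (cΛ₀ + s₂ * cΛ₁) cE₂ cB T j, TbalOf_JsBalAn1 hLc hr (cE₀ + s₃ * cE₁) (cVH₀ + s₃ * cVH₁) (cΛ₀ + s₃ * cΛ₁) cE₂ cB T j,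
    TbalOf_JsBalAn1 hLc hr (cE₀ + s₄ * cE₁) (cVH₀ + s₄ * cVH₁) (cΛ₀ + s₄ * cΛ₁) cE₂ cB T j, hS t, hS s₀, hS s₁, hS s₂, hS s₃, hS s₄]
  simp only [ExpKernelCalculus.hessKer]
  unfold BalabanStepW2.WbalT2Of
  rw [hV t (μ, 0), hV t (ν, z), hV s₀ (μ, 0), hV s₀ (ν, z), hV s₁ (μ, 0), hV s₁ (ν, z), hV s₂ (μ, 0), hV s₂ (ν, z), hV s₃ (μ, 0), hV s₃ (ν, z),
    hV s₄ (μ, 0), hV s₄ (ν, z)]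
  linear_combination (1 / 2 : ℝ) * htad - (1 / 2 : ℝ) * hbub

/-- [folklore] **THE PINNED FAMILY's ONE-LOOP STEP COEFFICIENTS ALONG AN AFFINE LINE OF COLOUR TRIPLES IN THE FIVE-NODE FORM** (`1 ≤ Lc`; any `cE₂, cB, Tc`; any box root; every level;
every channel): `β⁰_j(r, c⃗₀ + t·c⃗₁) = Σᵢ wᵢ · β⁰_j(r, c⃗₀ + sᵢ·c⃗₁)` for weights of moments `Σ wᵢ sᵢ^k = t^k` (`k = 0,…,4`). -/
theorem secondMoment_JsBalAn1_line_nodes (hLc : 1 ≤ Lc) (hr : r ∈ box (3 + 1) Lc) (cE₀ cVH₀ cΛ₀ cE₁ cVH₁ cΛ₁ cE₂ cB : ℝ) (T : Fin 4 → Fin 4 → Fin 4 → Fin 4 → ℝ) (j : ℕ)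
    (t s₀ s₁ s₂ s₃ s₄ w₀ w₁ w₂ w₃ w₄ : ℝ) (hm0 : w₀ + w₁ + w₂ + w₃ + w₄ = 1) (hm1 : w₀ * s₀ + w₁ * s₁ + w₂ * s₂ + w₃ * s₃ + w₄ * s₄ = t)
    (hm2 : w₀ * s₀ ^ 2 + w₁ * s₁ ^ 2 + w₂ * s₂ ^ 2 + w₃ * s₃ ^ 2 + w₄ * s₄ ^ 2 = t ^ 2)
    (hm3 : w₀ * s₀ ^ 3 + w₁ * s₁ ^ 3 + w₂ * s₂ ^ 3 + w₃ * s₃ ^ 3 + w₄ * s₄ ^ 3 = t ^ 3) (hm4 : w₀ * s₀ ^ 4 + w₁ * s₁ ^ 4 + w₂ * s₂ ^ 4 + w₃ * s₃ ^ 4 + w₄ * s₄ ^ 4 = t ^ 4)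
    (μ ν : Fin 4) :
    B12Beta.secondMoment (TbalOf Lc (JsBalAn1 hLc hr (cE₀ + t * cE₁) (cVH₀ + t * cVH₁) (cΛ₀ + t * cΛ₁) cE₂ cB T) j) μ ν =
      w₀ * B12Beta.secondMoment (TbalOf Lc (JsBalAn1 hLc hr (cE₀ + s₀ * cE₁) (cVH₀ + s₀ * cVH₁) (cΛ₀ + s₀ * cΛ₁) cE₂ cB T) j) μ ν +
        w₁ * B12Beta.secondMoment (TbalOf Lc (JsBalAn1 hLc hr (cE₀ + s₁ * cE₁) (cVH₀ + s₁ * cVH₁) (cΛ₀ + s₁ * cΛ₁) cE₂ cB T) j) μ ν +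
        w₂ * B12Beta.secondMoment (TbalOf Lc (JsBalAn1 hLc hr (cE₀ + s₂ * cE₁) (cVH₀ + s₂ * cVH₁) (cΛ₀ + s₂ * cΛ₁) cE₂ cB T) j) μ ν +
        w₃ * B12Beta.secondMoment (TbalOf Lc (JsBalAn1 hLc hr (cE₀ + s₃ * cE₁) (cVH₀ + s₃ * cVH₁) (cΛ₀ + s₃ * cΛ₁) cE₂ cB T) j) μ ν +
        w₄ * B12Beta.secondMoment (TbalOf Lc (JsBalAn1 hLc hr (cE₀ + s₄ * cE₁) (cVH₀ + s₄ * cVH₁) (cΛ₀ + s₄ * cΛ₁) cE₂ cB T) j) μ ν := by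
  have hker : TbalOf Lc (JsBalAn1 hLc hr (cE₀ + t * cE₁) (cVH₀ + t * cVH₁) (cΛ₀ + t * cΛ₁) cE₂ cB T) j =
      w₀ • TbalOf Lc (JsBalAn1 hLc hr (cE₀ + s₀ * cE₁) (cVH₀ + s₀ * cVH₁) (cΛ₀ + s₀ * cΛ₁) cE₂ cB T) j +
        w₁ • TbalOf Lc (JsBalAn1 hLc hr (cE₀ + s₁ * cE₁) (cVH₀ + s₁ * cVH₁) (cΛ₀ + s₁ * cΛ₁) cE₂ cB T) j +
        w₂ • TbalOf Lc (JsBalAn1 hLc hr (cE₀ + s₂ * cE₁) (cVH₀ + s₂ * cVH₁) (cΛ₀ + s₂ * cΛ₁) cE₂ cB T) j +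
        w₃ • TbalOf Lc (JsBalAn1 hLc hr (cE₀ + s₃ * cE₁) (cVH₀ + s₃ * cVH₁) (cΛ₀ + s₃ * cΛ₁) cE₂ cB T) j +
        w₄ • TbalOf Lc (JsBalAn1 hLc hr (cE₀ + s₄ * cE₁) (cVH₀ + s₄ * cVH₁) (cΛ₀ + s₄ * cΛ₁) cE₂ cB T) j := by
    funext μ' ν' z
    simp only [Pi.add_apply, Pi.smul_apply, smul_eq_mul]
    exact TbalOf_JsBalAn1_line_nodes hLc hr cE₀ cVH₀ cΛ₀ cE₁ cVH₁ cΛ₁ cE₂ cB T j t s₀ s₁ s₂ s₃ s₄ w₀ w₁ w₂ w₃ w₄ hm0 hm1 hm2 hm3 hm4 μ' ν' z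
  rw [hker]
  exact secondMoment_wsum5 (hTA_TbalOf _ j) (hTA_TbalOf _ j) (hTA_TbalOf _ j) (hTA_TbalOf _ j) (hTA_TbalOf _ j) w₀ w₁ w₂ w₃ w₄ μ ν

end Kernels

/-! ## §4 UNCONDITIONAL at the pin `cE₂ := Lc^8`, `2 ≤ Lc`: the limit along an affine line of colour triples; five members decide (D1) on the line -/

section Pinned

variable {Lc : ℕ} [NeZero Lc] {r : Fin (3 + 1) → ℕ}

/-- [folklore] **THE LIMIT ONE-LOOP COEFFICIENT ALONG AN AFFINE LINE IN THE FIVE-NODE FORM, HYPOTHESIS-FREE** (pin `cE₂ := Lc^8`, `2 ≤ Lc`; any box root, `cB`, `Tc`, channel):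
`lim β⁰(r, c⃗₀ + t·c⃗₁; cB, Tc) = Σᵢ wᵢ · lim β⁰(r, c⃗₀ + sᵢ·c⃗₁; cB, Tc)` for weights of moments `Σ wᵢ sᵢ^k = t^k` (`k = 0,…,4`) — §3 + g1-p3's `tendsto_pinned` ×6 + `tendsto_nhds_unique`. -/
theorem lim_JsBalAn1_line_nodes (hLc : 2 ≤ Lc) (hr : r ∈ box (3 + 1) Lc) (cE₀ cVH₀ cΛ₀ cE₁ cVH₁ cΛ₁ cB : ℝ) (Tc : Fin 4 → Fin 4 → Fin 4 → Fin 4 → ℝ)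
    (t s₀ s₁ s₂ s₃ s₄ w₀ w₁ w₂ w₃ w₄ : ℝ) (hm0 : w₀ + w₁ + w₂ + w₃ + w₄ = 1) (hm1 : w₀ * s₀ + w₁ * s₁ + w₂ * s₂ + w₃ * s₃ + w₄ * s₄ = t)
    (hm2 : w₀ * s₀ ^ 2 + w₁ * s₁ ^ 2 + w₂ * s₂ ^ 2 + w₃ * s₃ ^ 2 + w₄ * s₄ ^ 2 = t ^ 2)
    (hm3 : w₀ * s₀ ^ 3 + w₁ * s₁ ^ 3 + w₂ * s₂ ^ 3 + w₃ * s₃ ^ 3 + w₄ * s₄ ^ 3 = t ^ 3) (hm4 : w₀ * s₀ ^ 4 + w₁ * s₁ ^ 4 + w₂ * s₂ ^ 4 + w₃ * s₃ ^ 4 + w₄ * s₄ ^ 4 = t ^ 4)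
    (μ ν : Fin 4) :
    CauchyRate.lim (fun j => B12Beta.secondMoment (TbalOf Lc (JsBalAn1 (one_le_of_two_le hLc) hr (cE₀ + t * cE₁) (cVH₀ + t * cVH₁) (cΛ₀ + t * cΛ₁) ((Lc : ℝ) ^ (2 * (3 + 1))) cB Tc) j) μ ν) =
      w₀ * CauchyRate.lim (fun j => B12Beta.secondMoment (TbalOf Lc (JsBalAn1 (one_le_of_two_le hLc) hr (cE₀ + s₀ * cE₁) (cVH₀ + s₀ * cVH₁) (cΛ₀ + s₀ * cΛ₁) ((Lc : ℝ) ^ (2 * (3 + 1))) cB Tc) j) μ ν) +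
        w₁ * CauchyRate.lim (fun j => B12Beta.secondMoment (TbalOf Lc (JsBalAn1 (one_le_of_two_le hLc) hr (cE₀ + s₁ * cE₁) (cVH₀ + s₁ * cVH₁) (cΛ₀ + s₁ * cΛ₁) ((Lc : ℝ) ^ (2 * (3 + 1))) cB Tc) j) μ ν) +
        w₂ * CauchyRate.lim (fun j => B12Beta.secondMoment (TbalOf Lc (JsBalAn1 (one_le_of_two_le hLc) hr (cE₀ + s₂ * cE₁) (cVH₀ + s₂ * cVH₁) (cΛ₀ + s₂ * cΛ₁) ((Lc : ℝ) ^ (2 * (3 + 1))) cB Tc) j) μ ν) +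
        w₃ * CauchyRate.lim (fun j => B12Beta.secondMoment (TbalOf Lc (JsBalAn1 (one_le_of_two_le hLc) hr (cE₀ + s₃ * cE₁) (cVH₀ + s₃ * cVH₁) (cΛ₀ + s₃ * cΛ₁) ((Lc : ℝ) ^ (2 * (3 + 1))) cB Tc) j) μ ν) +
        w₄ * CauchyRate.lim (fun j => B12Beta.secondMoment (TbalOf Lc (JsBalAn1 (one_le_of_two_le hLc) hr (cE₀ + s₄ * cE₁) (cVH₀ + s₄ * cVH₁) (cΛ₀ + s₄ * cΛ₁) ((Lc : ℝ) ^ (2 * (3 + 1))) cB Tc) j) μ ν) := by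
  have ht := tendsto_pinned hLc hr (cE₀ + t * cE₁) (cVH₀ + t * cVH₁) (cΛ₀ + t * cΛ₁) cB Tc μ ν
  have h₀ := tendsto_pinned hLc hr (cE₀ + s₀ * cE₁) (cVH₀ + s₀ * cVH₁) (cΛ₀ + s₀ * cΛ₁) cB Tc μ ν
  have h₁ := tendsto_pinned hLc hr (cE₀ + s₁ * cE₁) (cVH₀ + s₁ * cVH₁) (cΛ₀ + s₁ * cΛ₁) cB Tc μ ν
  have h₂ := tendsto_pinned hLc hr (cE₀ + s₂ * cE₁) (cVH₀ + s₂ * cVH₁) (cΛ₀ + s₂ * cΛ₁) cB Tc μ ν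
  have h₃ := tendsto_pinned hLc hr (cE₀ + s₃ * cE₁) (cVH₀ + s₃ * cVH₁) (cΛ₀ + s₃ * cΛ₁) cB Tc μ ν
  have h₄ := tendsto_pinned hLc hr (cE₀ + s₄ * cE₁) (cVH₀ + s₄ * cVH₁) (cΛ₀ + s₄ * cΛ₁) cB Tc μ ν
  exact tendsto_nhds_unique ht ((((((h₀.const_mul w₀).add (h₁.const_mul w₁)).add (h₂.const_mul w₂)).add (h₃.const_mul w₃)).add (h₄.const_mul w₄)).congr
    fun j => (secondMoment_JsBalAn1_line_nodes (one_le_of_two_le hLc) hr cE₀ cVH₀ cΛ₀ cE₁ cVH₁ cΛ₁ _ cB Tc j t s₀ s₁ s₂ s₃ s₄ w₀ w₁ w₂ w₃ w₄ hm0 hm1 hm2 hm3 hm4 μ ν).symm)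

/-- [folklore] **FIVE MEMBERS GIVE THE WHOLE LINE — THE LIMIT ALONG AN AFFINE LINE OF COLOUR TRIPLES IS A QUARTIC IN THE LINE PARAMETER, HYPOTHESIS-FREE**:
`lim β⁰(r, c⃗₀ + t·c⃗₁; cB, Tc) = Σ_{i=0}^{4} ℓᵢ(t)·lim β⁰(r, c⃗₀ + i·c⃗₁; cB, Tc)` with the Lagrange weights `ℓ₀ = (t−1)(t−2)(t−3)(t−4)/24`, `ℓ₁ = −t(t−2)(t−3)(t−4)/6`, `ℓ₂ = t(t−1)(t−3)(t−4)/4`,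
`ℓ₃ = −t(t−1)(t−2)(t−4)/6`, `ℓ₄ = t(t−1)(t−2)(t−3)/24` (moments `k = 0…4` by `ring`). -/
theorem lim_line_fiveMembers (hLc : 2 ≤ Lc) (hr : r ∈ box (3 + 1) Lc) (cE₀ cVH₀ cΛ₀ cE₁ cVH₁ cΛ₁ cB : ℝ) (Tc : Fin 4 → Fin 4 → Fin 4 → Fin 4 → ℝ) (μ ν : Fin 4) (t : ℝ) :
    CauchyRate.lim (fun j => B12Beta.secondMoment (TbalOf Lc (JsBalAn1 (one_le_of_two_le hLc) hr (cE₀ + t * cE₁) (cVH₀ + t * cVH₁) (cΛ₀ + t * cΛ₁) ((Lc : ℝ) ^ (2 * (3 + 1))) cB Tc) j) μ ν) =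
      (t - 1) * (t - 2) * (t - 3) * (t - 4) / 24 *
          CauchyRate.lim (fun j => B12Beta.secondMoment (TbalOf Lc (JsBalAn1 (one_le_of_two_le hLc) hr cE₀ cVH₀ cΛ₀ ((Lc : ℝ) ^ (2 * (3 + 1))) cB Tc) j) μ ν) +
        -(t * (t - 2) * (t - 3) * (t - 4) / 6) *
          CauchyRate.lim (fun j => B12Beta.secondMoment (TbalOf Lc (JsBalAn1 (one_le_of_two_le hLc) hr (cE₀ + cE₁) (cVH₀ + cVH₁) (cΛ₀ + cΛ₁) ((Lc : ℝ) ^ (2 * (3 + 1))) cB Tc) j) μ ν) +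
        t * (t - 1) * (t - 3) * (t - 4) / 4 *
          CauchyRate.lim (fun j => B12Beta.secondMoment (TbalOf Lc (JsBalAn1 (one_le_of_two_le hLc) hr (cE₀ + 2 * cE₁) (cVH₀ + 2 * cVH₁) (cΛ₀ + 2 * cΛ₁) ((Lc : ℝ) ^ (2 * (3 + 1))) cB Tc) j) μ ν) +
        -(t * (t - 1) * (t - 2) * (t - 4) / 6) *
          CauchyRate.lim (fun j => B12Beta.secondMoment (TbalOf Lc (JsBalAn1 (one_le_of_two_le hLc) hr (cE₀ + 3 * cE₁) (cVH₀ + 3 * cVH₁) (cΛ₀ + 3 * cΛ₁) ((Lc : ℝ) ^ (2 * (3 + 1))) cB Tc) j) μ ν) +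
        t * (t - 1) * (t - 2) * (t - 3) / 24 *
          CauchyRate.lim (fun j => B12Beta.secondMoment (TbalOf Lc (JsBalAn1 (one_le_of_two_le hLc) hr (cE₀ + 4 * cE₁) (cVH₀ + 4 * cVH₁) (cΛ₀ + 4 * cΛ₁) ((Lc : ℝ) ^ (2 * (3 + 1))) cB Tc) j) μ ν) := by
  have h := lim_JsBalAn1_line_nodes hLc hr cE₀ cVH₀ cΛ₀ cE₁ cVH₁ cΛ₁ cB Tc t 0 1 2 3 4 ((t - 1) * (t - 2) * (t - 3) * (t - 4) / 24) (-(t * (t - 2) * (t - 3) * (t - 4) / 6))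
    (t * (t - 1) * (t - 3) * (t - 4) / 4) (-(t * (t - 1) * (t - 2) * (t - 4) / 6)) (t * (t - 1) * (t - 2) * (t - 3) / 24) (by ring) (by ring) (by ring) (by ring) (by ring) μ ν
  simp only [zero_mul, one_mul, add_zero] at h
  exact h

/-- [folklore] **(D1) AT THE FIVE MEMBERS `t = 0, 1, 2, 3, 4` OF AN AFFINE LINE OF COLOUR TRIPLES IS (D1) ON THE WHOLE LINE, HYPOTHESIS-FREE** (same root, `cB`, `Tc`, numeral `N`, channel):
the Lagrange weights sum to `1` (g1-p3's `d1Drift_pinned_iff_lim_eq` ×6). -/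
theorem d1Drift_line_of_fiveMembers (hLc : 2 ≤ Lc) (hr : r ∈ box (3 + 1) Lc) (cE₀ cVH₀ cΛ₀ cE₁ cVH₁ cΛ₁ cB : ℝ) (Tc : Fin 4 → Fin 4 → Fin 4 → Fin 4 → ℝ) (μ ν : Fin 4) (N : ℝ)
    (h0 : D1Drift Lc (JsBalAn1 (one_le_of_two_le hLc) hr cE₀ cVH₀ cΛ₀ ((Lc : ℝ) ^ (2 * (3 + 1))) cB Tc) N μ ν)
    (h1 : D1Drift Lc (JsBalAn1 (one_le_of_two_le hLc) hr (cE₀ + cE₁) (cVH₀ + cVH₁) (cΛ₀ + cΛ₁) ((Lc : ℝ) ^ (2 * (3 + 1))) cB Tc) N μ ν)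
    (h2 : D1Drift Lc (JsBalAn1 (one_le_of_two_le hLc) hr (cE₀ + 2 * cE₁) (cVH₀ + 2 * cVH₁) (cΛ₀ + 2 * cΛ₁) ((Lc : ℝ) ^ (2 * (3 + 1))) cB Tc) N μ ν)
    (h3 : D1Drift Lc (JsBalAn1 (one_le_of_two_le hLc) hr (cE₀ + 3 * cE₁) (cVH₀ + 3 * cVH₁) (cΛ₀ + 3 * cΛ₁) ((Lc : ℝ) ^ (2 * (3 + 1))) cB Tc) N μ ν)
    (h4 : D1Drift Lc (JsBalAn1 (one_le_of_two_le hLc) hr (cE₀ + 4 * cE₁) (cVH₀ + 4 * cVH₁) (cΛ₀ + 4 * cΛ₁) ((Lc : ℝ) ^ (2 * (3 + 1))) cB Tc) N μ ν) (t : ℝ) :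
    D1Drift Lc (JsBalAn1 (one_le_of_two_le hLc) hr (cE₀ + t * cE₁) (cVH₀ + t * cVH₁) (cΛ₀ + t * cΛ₁) ((Lc : ℝ) ^ (2 * (3 + 1))) cB Tc) N μ ν := by
  rw [d1Drift_pinned_iff_lim_eq hLc hr] at h0 h1 h2 h3 h4 ⊢
  rw [lim_line_fiveMembers hLc hr cE₀ cVH₀ cΛ₀ cE₁ cVH₁ cΛ₁ cB Tc μ ν t, h0, h1, h2, h3, h4]
  ring

open Polynomial in
/-- [folklore] A real function of the five-member Lagrange form of `lim_line_fiveMembers` (a quartic) that takes the value `c` at more than four points is constantly `c`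
(`Polynomial.eq_zero_of_natDegree_lt_card_of_eval_eq_zero'`, `compute_degree`). -/
theorem quartic_dichotomy (f : ℝ → ℝ) (L₀ L₁ L₂ L₃ L₄ c : ℝ)
    (hf : ∀ t, f t = (t - 1) * (t - 2) * (t - 3) * (t - 4) / 24 * L₀ + -(t * (t - 2) * (t - 3) * (t - 4) / 6) * L₁ + t * (t - 1) * (t - 3) * (t - 4) / 4 * L₂ +
        -(t * (t - 1) * (t - 2) * (t - 4) / 6) * L₃ + t * (t - 1) * (t - 2) * (t - 3) / 24 * L₄)
    (S : Finset ℝ) (hS : 4 < S.card) (hD : ∀ s ∈ S, f s = c) (t : ℝ) : f t = c := by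
  let p : Polynomial ℝ := (X - 1) * (X - 2) * (X - 3) * (X - 4) * C (1 / 24 : ℝ) * C L₀ - X * (X - 2) * (X - 3) * (X - 4) * C (1 / 6 : ℝ) * C L₁ +
    X * (X - 1) * (X - 3) * (X - 4) * C (1 / 4 : ℝ) * C L₂ - X * (X - 1) * (X - 2) * (X - 4) * C (1 / 6 : ℝ) * C L₃ + X * (X - 1) * (X - 2) * (X - 3) * C (1 / 24 : ℝ) * C L₄ - C c
  have hev : ∀ s : ℝ, p.eval s = f s - c := fun s => by
    rw [hf s]; simp only [p, eval_add, eval_sub, eval_mul, eval_C, eval_X, eval_ofNat, eval_one]; ring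
  have hdeg : p.natDegree ≤ 4 := by simp only [p]; compute_degree!
  have hp : p = 0 :=
    Polynomial.eq_zero_of_natDegree_lt_card_of_eval_eq_zero' p S (fun s hs => by rw [hev s, sub_eq_zero]; exact hD s hs) (lt_of_le_of_lt hdeg hS)
  have ht := hev t
  rw [hp, eval_zero] at ht
  exact sub_eq_zero.mp ht.symm

/-- [folklore] **THE LINE DICHOTOMY, HYPOTHESIS-FREE: ALONG AN AFFINE LINE OF COLOUR TRIPLES (D1) HOLDS AT NO MORE THAN FOUR MEMBERS, OR AT ALL OF THEM** (same root, `cB`, `Tc`, numeral,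
channel): if the drift criterion holds on a finite set of more than four line parameters, it holds at every `t` (`lim_line_fiveMembers` + `quartic_dichotomy` + `d1Drift_pinned_iff_lim_eq`). -/
theorem d1Drift_line_dichotomy (hLc : 2 ≤ Lc) (hr : r ∈ box (3 + 1) Lc) (cE₀ cVH₀ cΛ₀ cE₁ cVH₁ cΛ₁ cB : ℝ) (Tc : Fin 4 → Fin 4 → Fin 4 → Fin 4 → ℝ) (μ ν : Fin 4) (N : ℝ)
    (S : Finset ℝ) (hS : 4 < S.card)
    (hD : ∀ s ∈ S, D1Drift Lc (JsBalAn1 (one_le_of_two_le hLc) hr (cE₀ + s * cE₁) (cVH₀ + s * cVH₁) (cΛ₀ + s * cΛ₁) ((Lc : ℝ) ^ (2 * (3 + 1))) cB Tc) N μ ν) (t : ℝ) :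
    D1Drift Lc (JsBalAn1 (one_le_of_two_le hLc) hr (cE₀ + t * cE₁) (cVH₀ + t * cVH₁) (cΛ₀ + t * cΛ₁) ((Lc : ℝ) ^ (2 * (3 + 1))) cB Tc) N μ ν :=
  (d1Drift_pinned_iff_lim_eq hLc hr _ _ _ cB Tc μ ν N).mpr (quartic_dichotomy
    (f := fun s => CauchyRate.lim (fun j => B12Beta.secondMoment (TbalOf Lc (JsBalAn1 (one_le_of_two_le hLc) hr (cE₀ + s * cE₁) (cVH₀ + s * cVH₁) (cΛ₀ + s * cΛ₁)
      ((Lc : ℝ) ^ (2 * (3 + 1))) cB Tc) j) μ ν))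
    _ _ _ _ _ (B12Normalization.stepBal N Lc) (fun s => lim_line_fiveMembers hLc hr cE₀ cVH₀ cΛ₀ cE₁ cVH₁ cΛ₁ cB Tc μ ν s) S hS
    (fun s hs => (d1Drift_pinned_iff_lim_eq hLc hr _ _ _ cB Tc μ ν N).mp (hD s hs)) t)

/-- [folklore] **125 MEMBERS DECIDE (D1) ON ALL OF COLOUR SPACE, HYPOTHESIS-FREE** (same root, `cB`, `Tc`, numeral, channel): if the drift criterion holds at the members
`(cE₀ + i, cVH₀ + j, cΛ₀ + k)`, `i, j, k ∈ {0,…,4}`, of a unit grid of colour triples, it holds at EVERY colour triple — `d1Drift_line_of_fiveMembers` along the three axis directions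
(lines in the `cΛ`-direction through the grid, then the `cVH`-direction, then the `cE`-direction). -/
theorem d1Drift_of_grid125 (hLc : 2 ≤ Lc) (hr : r ∈ box (3 + 1) Lc) (cE₀ cVH₀ cΛ₀ cB : ℝ) (Tc : Fin 4 → Fin 4 → Fin 4 → Fin 4 → ℝ) (μ ν : Fin 4) (N : ℝ)
    (hgrid : ∀ i j k : ℕ, i ≤ 4 → j ≤ 4 → k ≤ 4 →
      D1Drift Lc (JsBalAn1 (one_le_of_two_le hLc) hr (cE₀ + i) (cVH₀ + j) (cΛ₀ + k) ((Lc : ℝ) ^ (2 * (3 + 1))) cB Tc) N μ ν)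
    (cE cVH cΛ : ℝ) : D1Drift Lc (JsBalAn1 (one_le_of_two_le hLc) hr cE cVH cΛ ((Lc : ℝ) ^ (2 * (3 + 1))) cB Tc) N μ ν := by
  -- lines in the `cΛ`-direction through the grid points `(i, j)`
  have s1 : ∀ i j : ℕ, i ≤ 4 → j ≤ 4 → ∀ z : ℝ,
      D1Drift Lc (JsBalAn1 (one_le_of_two_le hLc) hr (cE₀ + i) (cVH₀ + j) z ((Lc : ℝ) ^ (2 * (3 + 1))) cB Tc) N μ ν := by
    intro i j hi hj z
    have h := d1Drift_line_of_fiveMembers hLc hr (cE₀ + i) (cVH₀ + j) cΛ₀ 0 0 1 cB Tc μ ν N (by simpa using hgrid i j 0 hi hj (by norm_num))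
      (by simpa using hgrid i j 1 hi hj (by norm_num)) (by simpa using hgrid i j 2 hi hj (by norm_num)) (by simpa using hgrid i j 3 hi hj (by norm_num))
      (by simpa using hgrid i j 4 hi hj (by norm_num)) (z - cΛ₀)
    simpa using h
  -- lines in the `cVH`-direction through `(cE₀ + i, cVH₀, z)`
  have s2 : ∀ i : ℕ, i ≤ 4 → ∀ y z : ℝ, D1Drift Lc (JsBalAn1 (one_le_of_two_le hLc) hr (cE₀ + i) y z ((Lc : ℝ) ^ (2 * (3 + 1))) cB Tc) N μ ν := by
    intro i hi y z
    have h := d1Drift_line_of_fiveMembers hLc hr (cE₀ + i) cVH₀ z 0 1 0 cB Tc μ ν N (by simpa using s1 i 0 hi (by norm_num) z)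
      (by simpa using s1 i 1 hi (by norm_num) z) (by simpa using s1 i 2 hi (by norm_num) z) (by simpa using s1 i 3 hi (by norm_num) z)
      (by simpa using s1 i 4 hi (by norm_num) z) (y - cVH₀)
    simpa using h
  -- the line in the `cE`-direction through `(cE₀, cVH, cΛ)`
  have h := d1Drift_line_of_fiveMembers hLc hr cE₀ cVH cΛ 1 0 0 cB Tc μ ν N (by simpa using s2 0 (by norm_num) cVH cΛ) (by simpa using s2 1 (by norm_num) cVH cΛ)
    (by simpa using s2 2 (by norm_num) cVH cΛ) (by simpa using s2 3 (by norm_num) cVH cΛ) (by simpa using s2 4 (by norm_num) cVH cΛ) (cE - cE₀)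
  simpa using h

end Pinned

end Summit.QuantumFields.BalabanUV.Gaps.D1PinnedColourLineReadings

end
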